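import Summits.Ventures.HodgeRepro.FaceCensusRow12Dihedral
import Summits.Ventures.HodgeRepro.FaceCensusRow12Dicyclic
import Summits.Ventures.HodgeRepro.Night3CensusBridge

/-!
# The sealed census rows `Duodecic.Dihedral` and `Duodecic.Dicyclic` cover their faces up to Galois twist (kernel)

Blind re-derivation cell `pub-hodge-repro`, seat `night-3` (gen 3).  Imports p4's proofs of the sealed order-`12` census
rows (`FaceCensusRows12` with their `census` theorems, whose first clause is the group check) and night-3's
`Night3CensusBridge` (`coversFaces`, `coversTypes`, `coversFaces_of_chunks`, the transport `cover_of_coversFaces`).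
Namespace `HodgeRepro.Night3.Census`.

For each row, the cover check `coversFaces Γ reps = true` is decided on the kernel in FOUR CHUNKS of `16` CM types
(`coversTypes` on `take 16` / `drop 16` slices of `Γ.cmTypes`, each a `decide +kernel` within the default heartbeats;
`coversFaces_of_chunks` assembles them), and the transport reads it in the model: every face `(Φ; p, p')` of
`(Elt Γ, conj Γ)` has a corner multiset which is a right twist of the corner multiset of one of the sealed
representatives — the hypothesis `hcover` of night-3's twist reduction (`alg_of_faces_gset_reps`).  Nothing here closes
S4; no sealed file is touched; no Tier-2 item depends on this file.
-/

set_option autoImplicit false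

namespace HodgeRepro.Night3.Census

open Summit.Ventures.HodgeRepro.FaceCensus
open HodgeRepro.EngineBridge

/-! ### Row `Duodecic.Dihedral` — the dihedral duodecic row (26 representatives) -/

/-- The group check of the row, from p4's census theorem. -/
instance factDuodecicDihedral : Fact (Duodecic.Dihedral.Γ.isCMGaloisType = true) := ⟨Duodecic.Dihedral.census.1⟩

/-- Chunk 0 of the cover check (CM types `0`–`15` of `Γ.cmTypes`). -/
theorem coversTypes_duodecicDihedral_0 :
    coversTypes Duodecic.Dihedral.Γ (repTwists Duodecic.Dihedral.Γ Duodecic.Dihedral.reps) (Duodecic.Dihedral.Γ.cmTypes.take 16) = true := by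
  decide +kernel

/-- Chunk 1 of the cover check (CM types `16`–`31`). -/
theorem coversTypes_duodecicDihedral_1 :
    coversTypes Duodecic.Dihedral.Γ (repTwists Duodecic.Dihedral.Γ Duodecic.Dihedral.reps) ((Duodecic.Dihedral.Γ.cmTypes.drop 16).take 16) = true := by
  decide +kernel

/-- Chunk 2 of the cover check (CM types `32`–`47`). -/
theorem coversTypes_duodecicDihedral_2 :
    coversTypes Duodecic.Dihedral.Γ (repTwists Duodecic.Dihedral.Γ Duodecic.Dihedral.reps) (((Duodecic.Dihedral.Γ.cmTypes.drop 16).drop 16).take 16) = true := by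
  decide +kernel

/-- Chunk 3 of the cover check (CM types `48`–`63`). -/
theorem coversTypes_duodecicDihedral_3 :
    coversTypes Duodecic.Dihedral.Γ (repTwists Duodecic.Dihedral.Γ Duodecic.Dihedral.reps) (((Duodecic.Dihedral.Γ.cmTypes.drop 16).drop 16).drop 16) = true := by
  decide +kernel

/-- The cover check of the row `Duodecic.Dihedral` (assembled from the four chunks). -/
theorem coversFaces_duodecicDihedral : coversFaces Duodecic.Dihedral.Γ Duodecic.Dihedral.reps = true :=
  coversFaces_of_chunks Duodecic.Dihedral.Γ Duodecic.Dihedral.reps coversTypes_duodecicDihedral_0 coversTypes_duodecicDihedral_1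
    coversTypes_duodecicDihedral_2 coversTypes_duodecicDihedral_3

/-- **Row `Duodecic.Dihedral`**: every face of the model is a twist of a sealed representative. -/
theorem cover_duodecicDihedral (Φ : Finset (Elt Duodecic.Dihedral.Γ)) (p p' : Elt Duodecic.Dihedral.Γ)
    (hΦ : IsCMType (Elt.conj Duodecic.Dihedral.Γ) Φ) (hp : p' ∉ place (Elt.conj Duodecic.Dihedral.Γ) p) :
    ∃ r ∈ Duodecic.Dihedral.reps, ∃ g : Elt Duodecic.Dihedral.Γ,
      GSet.faceCornersMul (Elt.conj Duodecic.Dihedral.Γ) Φ p p' = (cornersMul Duodecic.Dihedral.Γ r).map fun S => rmul S g :=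
  cover_of_coversFaces Duodecic.Dihedral.Γ Duodecic.Dihedral.reps coversFaces_duodecicDihedral Φ p p' hΦ hp

/-! ### Row `Duodecic.Dicyclic` — the dicyclic row (20 representatives) -/

/-- The group check of the row, from p4's census theorem. -/
instance factDuodecicDicyclic : Fact (Duodecic.Dicyclic.Γ.isCMGaloisType = true) := ⟨Duodecic.Dicyclic.census.1⟩

/-- Chunk 0 of the cover check (CM types `0`–`15` of `Γ.cmTypes`). -/
theorem coversTypes_duodecicDicyclic_0 :
    coversTypes Duodecic.Dicyclic.Γ (repTwists Duodecic.Dicyclic.Γ Duodecic.Dicyclic.reps) (Duodecic.Dicyclic.Γ.cmTypes.take 16) = true := by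
  decide +kernel

/-- Chunk 1 of the cover check (CM types `16`–`31`). -/
theorem coversTypes_duodecicDicyclic_1 :
    coversTypes Duodecic.Dicyclic.Γ (repTwists Duodecic.Dicyclic.Γ Duodecic.Dicyclic.reps) ((Duodecic.Dicyclic.Γ.cmTypes.drop 16).take 16) = true := by
  decide +kernel

/-- Chunk 2 of the cover check (CM types `32`–`47`). -/
theorem coversTypes_duodecicDicyclic_2 :
    coversTypes Duodecic.Dicyclic.Γ (repTwists Duodecic.Dicyclic.Γ Duodecic.Dicyclic.reps) (((Duodecic.Dicyclic.Γ.cmTypes.drop 16).drop 16).take 16) = true := by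
  decide +kernel

/-- Chunk 3 of the cover check (CM types `48`–`63`). -/
theorem coversTypes_duodecicDicyclic_3 :
    coversTypes Duodecic.Dicyclic.Γ (repTwists Duodecic.Dicyclic.Γ Duodecic.Dicyclic.reps) (((Duodecic.Dicyclic.Γ.cmTypes.drop 16).drop 16).drop 16) = true := by
  decide +kernel

/-- The cover check of the row `Duodecic.Dicyclic` (assembled from the four chunks). -/
theorem coversFaces_duodecicDicyclic : coversFaces Duodecic.Dicyclic.Γ Duodecic.Dicyclic.reps = true :=
  coversFaces_of_chunks Duodecic.Dicyclic.Γ Duodecic.Dicyclic.reps coversTypes_duodecicDicyclic_0 coversTypes_duodecicDicyclic_1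
    coversTypes_duodecicDicyclic_2 coversTypes_duodecicDicyclic_3

/-- **Row `Duodecic.Dicyclic`**: every face of the model is a twist of a sealed representative. -/
theorem cover_duodecicDicyclic (Φ : Finset (Elt Duodecic.Dicyclic.Γ)) (p p' : Elt Duodecic.Dicyclic.Γ)
    (hΦ : IsCMType (Elt.conj Duodecic.Dicyclic.Γ) Φ) (hp : p' ∉ place (Elt.conj Duodecic.Dicyclic.Γ) p) :
    ∃ r ∈ Duodecic.Dicyclic.reps, ∃ g : Elt Duodecic.Dicyclic.Γ,
      GSet.faceCornersMul (Elt.conj Duodecic.Dicyclic.Γ) Φ p p' = (cornersMul Duodecic.Dicyclic.Γ r).map fun S => rmul S g :=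
  cover_of_coversFaces Duodecic.Dicyclic.Γ Duodecic.Dicyclic.reps coversFaces_duodecicDicyclic Φ p p' hΦ hp

end HodgeRepro.Night3.Census
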